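import Literature.AlgebraicGeometry.Hironaka2017.Lib.IdealSheafGlueCover
import HarnessLib

/-!
# [OURS · L1 W4.5(b) · EL♮(3) · J1c (π) brick F3] Gluing a quasi-coherent ideal sheaf from compatible FAMILIES of chart ideals

Crux chain w45b (cell `res-hironaka`, slot W4.5(b)), child crux **EL♮(3)** = stmt-ResolutionOfSingularities-20148; J1 =
`EmbeddedInfinitesimalLiftFact` (p596985), discharge programme J1c, brick **(π)** (patching engine, res-type-027 g17, object split
STATUS 2026-08-28T05:26Z). OURS; NOT a statement of H. Hironaka's 2017 manuscript; AI-written, gate-checked, weaker than expert review.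
No `sorry`; standard axioms. ONE definition (`glueFamily`, review lane) + its unfolding `glueFamilyIdeals`.
`--supports stmt-ResolutionOfSingularities-20148 --as helper`.

The tree's `Literature.AlgebraicGeometry.Hironaka2017.S02Preliminaries.IdealSheafGlueCover.glue` glues ideal sheaves `N i` given GLOBALLY on
`X` that agree on the overlaps of a cover `V i`. The patching engine produces its local lifts as IDEALS OF CHART RINGS `J_i ≤ Γ(X, U_i)` (`U_i`
affine), i.e. as the families `U' ↦ J_i·Γ(X, U')` on the affine opens `U' ⊆ U_i`, not as global ideal sheaves. This file is the family form of the
same gluing (Hartshorne II Ex. 1.22 + Prop. 5.4: quasi-coherence is local), with the proofs of the Lib file transcribed hypothesis-for-hypothesis: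

* data: opens `V i` covering `X` and, for each `i`, ideals `F i U' ≤ Γ(X, U')` for the affine opens `U'` (only the values with `U' ⊆ V i` matter),
  subject to RESTRICTION `(F i U')·Γ(X, U'') = F i U''` for affine `U'' ⊆ U' ⊆ V i` (this contains the localisation property `I(D(f)) = I(U')_f`)
  and AGREEMENT `F i U' = F j U'` for affine `U' ⊆ V i ∩ V j`;
* `glueFamilyIdeals`, `glueFamily : X.IdealSheafData` — the glued quasi-coherent ideal sheaf; `glueFamily_ideal_eq_of_le` — it restricts to the
  given families: `(glueFamily …).ideal U' = F i U'` for every affine `U' ⊆ V i`;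
* `exists_idealSheafData_forall_ideal_eq_family` — existence form; `map_res_map_res` — chart ideals `U' ↦ J·Γ(X, U')` restrict.

References (method / index only): R. Hartshorne, *Algebraic Geometry* (1977), II Ex. 1.22, Lemma 5.3, Prop. 5.4; EGA I (1971) 0.3.3.
-/

noncomputable section

open CategoryTheory TopologicalSpace Opposite
open _root_.AlgebraicGeometry
open Literature.AlgebraicGeometry.Hironaka2017.S02Preliminaries.IdealSheafGlueCover (res res_res res_eq_res)

set_option linter.dupNamespace false -- mandated namespace `Summit.<Summit>.<Problem>` of this single-conjunct summit

universe u

namespace Summit.ResolutionOfSingularities.ResolutionOfSingularities.Cruxes.EquisingularLiftNat.Sections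

namespace IdealSheafGlueFamily

variable {X : Scheme.{u}}

/-! ## Local facts about ONE family with the localisation property -/

/-- If `(F U)·Γ(X, D(g)) = F(D(g))` and the restriction of `s ∈ Γ(X,U)` to `D(g)` lies in `F(D(g))`, then `gⁿ s ∈ F U` for some `n`
(sections over `D(g)` are fractions `x / gⁿ`). [cite: Hartshorne1977, Ch. II Lemma 5.3 (b), p. 112] -/
theorem exists_pow_mul_mem_of_res_mem (U : X.affineOpens) (FU : Ideal Γ(X, U)) (g : Γ(X, U))
    (FD : Ideal Γ(X, X.affineBasicOpen g)) (hF : FU.map (res (X.basicOpen_le g)) = FD) (s : Γ(X, U))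
    (h : res (X.basicOpen_le g) s ∈ FD) : ∃ n : ℕ, g ^ n * s ∈ FU := by
  letI := U.2.isLocalization_basicOpen g
  rw [← hF] at h
  change algebraMap Γ(X, U) Γ(X, X.basicOpen g) s ∈ FU.map (algebraMap Γ(X, U) Γ(X, X.basicOpen g)) at h
  obtain ⟨⟨⟨c, hc⟩, ⟨_, ⟨e, rfl⟩⟩⟩, hce⟩ :=
    (IsLocalization.mem_map_algebraMap_iff (Submonoid.powers g) Γ(X, X.basicOpen g)).1 h
  simp only at hce
  rw [← map_mul] at hce
  obtain ⟨⟨_, ⟨e', rfl⟩⟩, he'⟩ := (IsLocalization.eq_iff_exists (Submonoid.powers g) Γ(X, X.basicOpen g)).1 hce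
  simp only at he'
  refine ⟨e' + e, ?_⟩
  rw [pow_add, mul_assoc, mul_comm (g ^ e) s, he']
  exact Ideal.mul_mem_left _ _ hc

/-- Membership in `F U` is local on the affine open `U` when `F` has the localisation property on the basic opens of `U`: if every point of `U`
has a basic open neighbourhood `D(g)` with `s|_{D(g)} ∈ F(D(g))`, then `s ∈ F U`. [cite: Hartshorne1977, Ch. II Lemma 5.3 and Prop. 5.4, pp. 112–113] -/
theorem mem_of_forall_basicOpen (U : X.affineOpens) (F : ∀ U' : X.affineOpens, Ideal Γ(X, U'))
    (hF : ∀ g : Γ(X, U), (F U).map (res (X.basicOpen_le g)) = F (X.affineBasicOpen g)) (s : Γ(X, U))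
    (h : ∀ x ∈ (U : X.Opens), ∃ g : Γ(X, U), x ∈ X.basicOpen g ∧ res (X.basicOpen_le g) s ∈ F (X.affineBasicOpen g)) :
    s ∈ F U := by
  choose g hg using h
  let S : Set Γ(X, U) := Set.range fun x : (U : X.Opens) => g x.1 x.2
  have hspan : Ideal.span S = ⊤ := by
    rw [← U.2.self_le_iSup_basicOpen_iff]
    intro x hx
    exact Opens.mem_iSup.2 ⟨⟨g x hx, ⟨⟨x, hx⟩, rfl⟩⟩, (hg x hx).1⟩
  refine Submodule.mem_of_span_eq_top_of_smul_pow_mem (F U) S hspan s fun r => ?_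
  obtain ⟨⟨x, hx⟩, hr⟩ := r.2
  obtain ⟨n, hn⟩ := exists_pow_mul_mem_of_res_mem U (F U) (g x hx) _ (hF (g x hx)) s (hg x hx).2
  exact ⟨n, by rw [smul_eq_mul, ← hr]; exact hn⟩

/-! ## The glued family of ideals -/

variable {ι : Type*} (V : ι → X.Opens) (F : ι → ∀ U' : X.affineOpens, Ideal Γ(X, U'))

/-- **The glued ideals**: a section over the affine open `U` is admitted iff its restriction to every affine open `U' ⊆ U ∩ V i` lies in
`F i U'`, for every `i`. [cite: Hartshorne1977, Ch. II Exercise 1.22 (glueing sheaves), p. 69] -/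
def glueFamilyIdeals (U : X.affineOpens) : Ideal Γ(X, U) :=
  ⨅ (i : ι), ⨅ (U' : X.affineOpens), ⨅ (h : (U' : X.Opens) ≤ (U : X.Opens) ⊓ V i), (F i U').comap (res (h.trans inf_le_left))

/-- Membership in the glued ideal, unfolded. [folklore] -/
theorem mem_glueFamilyIdeals {U : X.affineOpens} {t : Γ(X, U)} :
    t ∈ glueFamilyIdeals V F U ↔
      ∀ (i : ι) (U' : X.affineOpens) (h : (U' : X.Opens) ≤ (U : X.Opens) ⊓ V i), res (h.trans inf_le_left) t ∈ F i U' := by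
  simp only [glueFamilyIdeals, Ideal.mem_iInf, Ideal.mem_comap]

/-- The glued ideals restrict into each other along affine opens `U₁ ≤ U`. [folklore] -/
theorem res_mem_glueFamilyIdeals {U U₁ : X.affineOpens} (hU : (U₁ : X.Opens) ≤ U) {t : Γ(X, U)} (ht : t ∈ glueFamilyIdeals V F U) :
    res hU t ∈ glueFamilyIdeals V F U₁ := by
  rw [mem_glueFamilyIdeals] at ht ⊢
  intro i U' h
  rw [res_res]
  exact ht i U' (le_inf ((h.trans inf_le_left).trans hU) (h.trans inf_le_right))

variable (hV : ∀ x : X, ∃ i, x ∈ V i)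
  (hres : ∀ (i : ι) (U' U'' : X.affineOpens) (_ : (U' : X.Opens) ≤ V i) (h : (U'' : X.Opens) ≤ U'), (F i U').map (res h) = F i U'')
  (hF : ∀ (i j : ι) (U' : X.affineOpens), (U' : X.Opens) ≤ V i ⊓ V j → F i U' = F j U')

include hres in
/-- Restriction maps `F i U'` into `F i U''` for affine `U'' ≤ U' ⊆ V i`. [folklore] -/
theorem res_mem_family {i : ι} {U' U'' : X.affineOpens} (hU' : (U' : X.Opens) ≤ V i) (h : (U'' : X.Opens) ≤ U') {s : Γ(X, U')}
    (hs : s ∈ F i U') : res h s ∈ F i U'' := by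
  rw [← hres i U' U'' hU' h]
  exact Ideal.mem_map_of_mem _ hs

include hres in
/-- The localisation property of each family on the affine opens inside `V i`. [folklore] -/
theorem map_res_basicOpen_family {i : ι} {U' : X.affineOpens} (hU' : (U' : X.Opens) ≤ V i) (g : Γ(X, U')) :
    (F i U').map (res (X.basicOpen_le g)) = F i (X.affineBasicOpen g) :=
  hres i U' (X.affineBasicOpen g) hU' (X.basicOpen_le g)

include hres hF in
/-- On an affine open `U' ⊆ V i`, the glued ideal IS `F i U'`. [cite: Hartshorne1977, Ch. II Exercise 1.22 (glueing sheaves), p. 69] -/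
theorem glueFamilyIdeals_eq_of_le {i : ι} {U' : X.affineOpens} (hU' : (U' : X.Opens) ≤ V i) : glueFamilyIdeals V F U' = F i U' := by
  apply le_antisymm
  · intro t ht
    rw [mem_glueFamilyIdeals] at ht
    have := ht i U' (le_inf le_rfl hU')
    have hid : res (le_refl (U' : X.Opens)) t = t := by
      change (X.presheaf.map (homOfLE le_rfl).op) t = t
      have : (homOfLE (le_refl (U' : X.Opens))).op = 𝟙 _ := rfl
      rw [this, X.presheaf.map_id]; rfl
    rw [res_eq_res _ (le_refl _), hid] at this
    exact this
  · intro t ht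
    rw [mem_glueFamilyIdeals]
    intro j U'' h
    rw [← hF i j U'' (le_inf ((h.trans inf_le_left).trans hU') (h.trans inf_le_right))]
    exact res_mem_family V F hres hU' (h.trans inf_le_left) ht

include hV hres hF in
/-- **Quasi-coherence of the glued ideals** (key step, as in the Lib file: write `t = a / f^m`, cover `U` by finitely many affine `W_k ⊆ U ∩ V(i_k)`,
find a common power `f^M a` in the glued ideal of `U`). [cite: Hartshorne1977, Ch. II Prop. 5.4 with Lemma 5.3, pp. 112–113] -/
theorem glueFamilyIdeals_basicOpen_le_map (U : X.affineOpens) (f : Γ(X, U)) :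
    glueFamilyIdeals V F (X.affineBasicOpen f) ≤ (glueFamilyIdeals V F U).map (res (X.basicOpen_le f)) := by
  intro t ht
  change Γ(X, X.basicOpen f) at t
  letI := U.2.isLocalization_basicOpen f
  obtain ⟨⟨a, ⟨_, ⟨m, rfl⟩⟩⟩, hat⟩ := IsLocalization.surj (M := Submonoid.powers f) (S := Γ(X, X.basicOpen f)) t
  simp only at hat
  have hcov : ∀ x ∈ (U : Set X), ∃ q : Σ i, X.affineOpens, (q.2 : X.Opens) ≤ (U : X.Opens) ⊓ V q.1 ∧ x ∈ (q.2 : X.Opens) := by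
    intro x hx
    obtain ⟨i, hi⟩ := hV x
    obtain ⟨W, hW, hxW, hWU⟩ := exists_isAffineOpen_mem_and_subset (U := (U : X.Opens) ⊓ V i) ⟨hx, hi⟩
    exact ⟨⟨i, ⟨W, hW⟩⟩, hWU, hxW⟩
  let Q := {q : Σ i, X.affineOpens // (q.2 : X.Opens) ≤ (U : X.Opens) ⊓ V q.1}
  obtain ⟨T, hT⟩ := U.2.isCompact.elim_finite_subcover (fun q : Q => ((q.1.2 : X.Opens) : Set X)) (fun q => (q.1.2 : X.Opens).2)
    (fun x hx => by
      obtain ⟨q, hq, hxq⟩ := hcov x hx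
      exact Set.mem_iUnion.2 ⟨⟨q, hq⟩, hxq⟩)
  have hloc : ∀ q : Q, ∃ d : ℕ, res (q.2.trans inf_le_left) (f ^ d * a) ∈ F q.1.1 q.1.2 := by
    rintro ⟨⟨i, W⟩, hW⟩
    have hWU : (W : X.Opens) ≤ U := hW.trans inf_le_left
    have hWV : (W : X.Opens) ≤ V i := hW.trans inf_le_right
    let fW : Γ(X, W) := res hWU f
    have hD : X.basicOpen fW = (W : X.Opens) ⊓ X.basicOpen f := Scheme.basicOpen_res _ _ _
    have hDle : X.basicOpen fW ≤ X.basicOpen f := hD.trans_le inf_le_right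
    have hDle' : (X.affineBasicOpen fW : X.Opens) ≤ (X.affineBasicOpen f : X.Opens) ⊓ V i :=
      le_inf hDle ((hD.trans_le inf_le_left).trans hWV)
    have h1 : res hDle t ∈ F i (X.affineBasicOpen fW) := by
      have := (mem_glueFamilyIdeals V F).1 ht i (X.affineBasicOpen fW) hDle'
      rwa [res_eq_res] at this
    have h2 : res (X.basicOpen_le fW) (res hWU a) ∈ F i (X.affineBasicOpen fW) := by
      rw [res_res, res_eq_res _ (hDle.trans (X.basicOpen_le f)), ← res_res (X.basicOpen_le f) hDle]
      change res hDle (algebraMap Γ(X, U) Γ(X, X.basicOpen f) a) ∈ _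
      rw [← hat, map_mul]
      exact Ideal.mul_mem_right _ _ h1
    obtain ⟨d, hd⟩ := exists_pow_mul_mem_of_res_mem W (F i W) fW (F i (X.affineBasicOpen fW))
      (map_res_basicOpen_family V F hres hWV fW) (res hWU a) h2
    refine ⟨d, ?_⟩
    change res hWU (f ^ d * a) ∈ _
    rw [map_mul, map_pow]
    exact hd
  choose d hd using hloc
  let M : ℕ := T.sup d
  have hM : ∀ q ∈ T, res (q.2.trans inf_le_left) (f ^ M * a) ∈ F q.1.1 q.1.2 := by
    intro q hq
    have hle : d q ≤ M := Finset.le_sup hq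
    obtain ⟨c, hc⟩ := Nat.exists_eq_add_of_le hle
    rw [hc, add_comm, pow_add, mul_assoc, map_mul]
    exact Ideal.mul_mem_left _ _ (hd q)
  have hmem : f ^ M * a ∈ glueFamilyIdeals V F U := by
    rw [mem_glueFamilyIdeals]
    intro i U' hU'
    apply mem_of_forall_basicOpen U' (F i) (fun g => map_res_basicOpen_family V F hres (hU'.trans inf_le_right) g)
    intro x hx
    have hxU : x ∈ (U : Set X) := hU'.trans inf_le_left hx
    obtain ⟨q, hqT, hxq⟩ : ∃ q ∈ T, x ∈ ((q.1.2 : X.Opens) : Set X) := by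
      simpa only [Set.mem_iUnion, exists_prop] using hT hxU
    obtain ⟨g, hgW, hxg⟩ := U'.2.exists_basicOpen_le ⟨x, hxq⟩ hx
    refine ⟨g, hxg, ?_⟩
    have hgi : (X.affineBasicOpen g : X.Opens) ≤ V i ⊓ V q.1.1 :=
      le_inf ((X.basicOpen_le g).trans (hU'.trans inf_le_right)) (hgW.trans (q.2.trans inf_le_right))
    rw [hF i q.1.1 (X.affineBasicOpen g) hgi, res_res, res_eq_res _ (hgW.trans (q.2.trans inf_le_left)),
      ← res_res (q.2.trans inf_le_left) hgW]
    exact res_mem_family V F hres (q.2.trans inf_le_right) hgW (hM q hqT)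
  have hunit : IsUnit (algebraMap Γ(X, U) Γ(X, X.basicOpen f) (f ^ (M + m))) :=
    IsLocalization.map_units (M := Submonoid.powers f) Γ(X, X.basicOpen f) ⟨f ^ (M + m), M + m, rfl⟩
  obtain ⟨u, hu⟩ := hunit
  have key : algebraMap Γ(X, U) Γ(X, X.basicOpen f) (f ^ M) * algebraMap Γ(X, U) Γ(X, X.basicOpen f) (f ^ m) *
      (↑u⁻¹ : Γ(X, X.basicOpen f)) = 1 := by
    rw [← map_mul, ← pow_add, ← hu, Units.mul_inv]
  have ht' : t = algebraMap Γ(X, U) Γ(X, X.basicOpen f) (f ^ M * a) * (↑u⁻¹ : Γ(X, X.basicOpen f)) := by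
    calc t = t * 1 := (mul_one _).symm
      _ = t * (algebraMap Γ(X, U) Γ(X, X.basicOpen f) (f ^ M) * algebraMap Γ(X, U) Γ(X, X.basicOpen f) (f ^ m) *
          (↑u⁻¹ : Γ(X, X.basicOpen f))) := by rw [key]
      _ = algebraMap Γ(X, U) Γ(X, X.basicOpen f) (f ^ M * a) * (↑u⁻¹ : Γ(X, X.basicOpen f)) := by rw [map_mul, ← hat]; ring
  have : t ∈ (glueFamilyIdeals V F U).map (res (X.basicOpen_le f)) := by
    rw [ht']
    exact Ideal.mul_mem_right _ _ (Ideal.mem_map_of_mem _ hmem)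
  exact this

/-- **The glued quasi-coherent ideal sheaf** of the compatible families `F i` on the cover `V i`.
[cite: Hartshorne1977, Ch. II Exercise 1.22 and Prop. 5.4, pp. 69, 113] -/
def glueFamily : X.IdealSheafData where
  ideal := glueFamilyIdeals V F
  map_ideal_basicOpen U f := by
    apply le_antisymm
    · rw [Ideal.map_le_iff_le_comap]
      intro t ht
      exact res_mem_glueFamilyIdeals V F (X.basicOpen_le f) ht
    · exact glueFamilyIdeals_basicOpen_le_map V F hV hres hF U f

/-- The sections of the glued sheaf are the glued ideals. [folklore] -/
@[simp] theorem glueFamily_ideal (U : X.affineOpens) : (glueFamily V F hV hres hF).ideal U = glueFamilyIdeals V F U := rfl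

/-- **The glued sheaf restricts to the given families**: `(glueFamily …).ideal U' = F i U'` for every affine `U' ⊆ V i`.
[cite: Hartshorne1977, Ch. II Exercise 1.22, p. 69] -/
theorem glueFamily_ideal_eq_of_le {i : ι} {U' : X.affineOpens} (hU' : (U' : X.Opens) ≤ V i) :
    (glueFamily V F hV hres hF).ideal U' = F i U' :=
  glueFamilyIdeals_eq_of_le V F hres hF hU'

end IdealSheafGlueFamily

open IdealSheafGlueFamily in
/-- **Gluing of quasi-coherent ideal sheaves from compatible families of chart ideals** (existence form): opens `V i` covering `X` and
families of ideals `F i U' ≤ Γ(X, U')` (`U'` affine) that restrict (`(F i U')·Γ(X,U'') = F i U''` for affine `U'' ⊆ U' ⊆ V i`) and agree on the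
overlaps are the values of ONE quasi-coherent ideal sheaf on the affine opens inside the `V i`. [cite: Hartshorne1977, Ch. II Exercise 1.22 and Prop. 5.4] -/
theorem exists_idealSheafData_forall_ideal_eq_family {X : Scheme.{u}} {ι : Type*} (V : ι → X.Opens) (hV : ∀ x : X, ∃ i, x ∈ V i)
    (F : ι → ∀ U' : X.affineOpens, Ideal Γ(X, U'))
    (hres : ∀ (i : ι) (U' U'' : X.affineOpens) (_ : (U' : X.Opens) ≤ V i) (h : (U'' : X.Opens) ≤ U'), (F i U').map (res h) = F i U'')
    (hF : ∀ (i j : ι) (U' : X.affineOpens), (U' : X.Opens) ≤ V i ⊓ V j → F i U' = F j U') :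
    ∃ G : X.IdealSheafData, ∀ (i : ι) (U' : X.affineOpens), (U' : X.Opens) ≤ V i → G.ideal U' = F i U' :=
  ⟨glueFamily V F hV hres hF, fun _ _ hU' => glueFamily_ideal_eq_of_le V F hV hres hF hU'⟩

/-- Restriction of chart ideals is transitive: `(J·Γ(X,U'))·Γ(X,U'') = J·Γ(X,U'')` for affine `U'' ≤ U' ≤ U` — the families
`U' ↦ J·Γ(X, U')` of ONE chart ideal satisfy the restriction hypothesis of `exists_idealSheafData_forall_ideal_eq_family`. [folklore] -/
theorem map_res_map_res {X : Scheme.{u}} {U U' U'' : X.affineOpens} (h : (U' : X.Opens) ≤ U) (h' : (U'' : X.Opens) ≤ U')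
    (J : Ideal Γ(X, U)) : (J.map (res h)).map (res h') = J.map (res (h'.trans h)) := by
  rw [Ideal.map_map]
  congr 1
  ext s
  exact res_res h h' s

end Summit.ResolutionOfSingularities.ResolutionOfSingularities.Cruxes.EquisingularLiftNat.Sections

end
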